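import Literature.MathematicalPhysics.QuantumLattice.GroundStateSourceBounds
import HarnessLib

/-!
# Barrier: the ε-lift — every sourced system has, at every precision ε > 0, an order-free companion
# with the same sourced ground energies (within ε) and the same sourced ground states at every field
# whose energy gain exceeds ε

Barrier catalogue `Literature/Barriers/HubbardSuperconductivity/` (D-0021), entry `SourcedResponseEpsilonLift`;
companion of `FiniteFieldResponseWithoutLRO.lean` (the gapped paramagnet: a fixed-field response floor does not
floor the order) and of `SourcedOrderWithoutGroundStateLRO(.lean, …KomaTasakiClass.lean)`.

The paramagnet answers "is there an order-free system with response `c` at field `h₀`?".  The present entry is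
the DATA-MATCHING form of the same obstruction (cell `hubbard-cq`, lens `negation-1`, memo NEGATION-SIZING v1 §S0,
adopted as census (13) of the cell's START-HERE): take ANY finite-dimensional Hermitian `H` ("symmetric
Hamiltonian") and `O` ("order operator") with vanishing symmetric one-point function `Re ω_H(O) = 0` (`ω_A` the
tracial ground-state functional `Matrix.groundStateFunctional A`, `E₀` = `Matrix.groundEnergy`; this is the
exact setting of the tree's sourced objects, e.g. `dWaveSourceTorus L U μ h = H − h(Δ_d + Δ_d†)`), and ANY
precision `ε > 0`.  Adjoin ONE inert level at energy `E₀(H) − ε` that carries no order: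

  `H̃ = H ⊕ (E₀(H) − ε)`,  `Õ = O ⊕ 0`  on `ℂⁿ ⊕ ℂ`   (`EpsilonLift.lift`, `EpsilonLift.liftOp`).

Then for EVERY field `h` (`sourcedResponseEpsilonLift_profile`):
* (i) ENERGIES agree to precision ε: `E₀(H̃ − hÕ) = min(E₀(H − hO), E₀(H) − ε) ∈ [E₀(H − hO) − ε, E₀(H − hO)]`;
* (ii) where the sourced energy gain `G(h) = E₀(H) − E₀(H − hO)` EXCEEDS ε, the sourced ground states are the
  physical ones: `ω̃_h(X̃) = ω_h(X)` for every lifted observable `X̃ = X ⊕ 0` — identical response `ω̃_h(Õ) = ω_h(O)`,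
  identical pair structure factor, identical everything;
* (iii) where `G(h) < ε` — in particular at `h = 0` and on the whole interval `|h| < ε/‖O‖` — the ground state is
  the inert level: `ω̃_h(X̃) = 0` for every `X`; so the lifted system has NO long-range order (`ω̃_0(ÕᴴÕ) = 0`), its
  response vanishes identically near `h = 0`, and its field-then-volume order parameter is `0`;
* (iv) symmetries transport: `C` commuting with `H` gives `C̃ = C ⊕ 0` commuting with `H̃`, with the same
  commutation relations against `Õ` (so a Koma–Tasaki `U(1)` structure lifts verbatim, the inert level being
  charge-neutral).

Hence (`SourcedResponseEpsilonLift_holds`): for every model and every finite set of certified sourced data of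
finite precision — energy windows `E₀(H − h_i O) ∈ [lo_i, hi_i]` of width ≥ ε, and response / correlation rows
read in sourced ground states at fields with gain `> ε` — there is a system with the SAME data and no order of
any kind.  Response data alone therefore force `g ≡ 0` in any inequality "certified finite-field data ⇒ LRO ≥ g"
at EVERY precision; what such data CAN exclude is only what the lift changes: the gain at small field (a MODULUS
of the response at `0⁺`, uniform in the volume) or locality/tensor-product structure at total-energy resolution
`ε` (the inert level is one global state; a site-local version with one inert level per site and a domain-wall
penalty is the translation-invariant form, not formalised here).

## Lean rendering

Index type of the lift: `n ⊕ Unit`; `lift A d = fromBlocks A 0 0 (d·1)`, `liftOp X = fromBlocks X 0 0 0`.  The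
spectral facts are proved from the tree's variational API (`FinDimSpectrumProofs`: `groundEnergy_le_rayleigh`,
`rayleigh_eq_groundEnergy_iff`, `groundSpace_ne_bot`, `groundProj_mulVec_mem/_of_mem`) — ground energy of a
block-diagonal matrix (`groundEnergy_lift`), the ground space when one block wins strictly
(`inl_eq_zero_of_mem_groundSpace_lift`, `mem_groundSpace_lift_iff`), and the identification of the ground
projection by the characterisation "Hermitian, maps into the ground space, fixes it" (`proj_unique`,
`groundProj_lift_eq`).  No `sorry`, no named fact, no new physics definitions (the two `def`s are the block
constructors).

technique_class: symmetry-breaking-field pinning-field finite-field-response finite-precision-data epsilon-lift quasi-average Koma-Tasaki-converse response-to-LRO-transfer energy-chord inert-level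
blocks: every certificate mechanism of the shape "finitely many certified SOURCED data of a `U(1)`-symmetric system — ground-energy windows of `H − h_i O` of width `≥ ε`, and rows (response `ω_{h_i}(O)`, structure factors, any observable) read in the sourced ground states at fields `h_i` whose energy gain exceeds `ε` — ⇒ a FLOOR on long-range order `ω_0(OᴴO)` of the symmetric ground states or on the order parameter `lim_{h↓0} lim_N ω_h(O)/N`", for any class of systems closed under adjoining an inert charge-neutral level (cell `hubbard-cq` obstruction O2, census (13); LADDER row PC-a).
because: the ε-lift `H ⊕ (E₀(H) − ε)`, `O ⊕ 0` reproduces every sourced ground energy within `ε` and every sourced ground state with gain `> ε` exactly, and has `ω̃_h(X̃) = 0` for all `X` whenever the gain is `< ε` (theorem `SourcedResponseEpsilonLift_holds`); the only printed theory runs LRO ⇒ response [cite: KomaTasaki1994, §1 and Corollary 2.9], the converse being open [cite: KomaTasaki1994, §2.5] [cite: LiebSeiringerYngvason2007, §3].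
evasions_known: (i) certify the SMALL-field gain itself, i.e. a volume-uniform modulus of the response at `0⁺` (floor-type input; `FiniteFieldResponseWithoutLRO` evasion (i)); (ii) use structure the global inert level breaks — strict tensor-product locality of ALL states below `E₀ + ε` in total energy (total-energy resolution `ε` on the whole torus, cell obstruction O1 escape (a)); (iii) the proved direction LRO ⇒ response [cite: KomaTasaki1994, Corollary 2.9] and direct LRO proofs [cite: KennedyLiebShastry1988].
scope_caveats: a statement about TRANSFER PRINCIPLES from finite-precision sourced data, not about any model; the lift is block-diagonal (one global inert state), so it lies outside classes defined by strict locality at total-energy scale ε — which is exactly the input a surviving card must certify; ties `G(h) = ε` are excluded from (ii)/(iii) (mixture of both blocks).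
status: established (theorems `EpsilonLift.sourcedResponseEpsilonLift_profile`, `SourcedResponseEpsilonLift_holds`).

## References
* T. Koma, H. Tasaki, J. Stat. Phys. 76 (1994) 745–803, arXiv:cond-mat/9708132 (`KomaTasaki1994`): §1 (order parameters
  under a source), Corollary 2.9, §2.5.
* E. H. Lieb, R. Seiringer, J. Yngvason, Rep. Math. Phys. 59 (2007) 389–399 (`LiebSeiringerYngvason2007`): §3.
* T. Kennedy, E. H. Lieb, B. S. Shastry, J. Stat. Phys. 53 (1988) 1019 (`KennedyLiebShastry1988`).
* Cell memo: `run/shared/lean/pub/hubbard-cq/hubbard-cq-lens-negation-1/NEGATION-SIZING.md` §S0 (ε-lift law; function-level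
  lemmas `epsLift_*` in that seat's Sketch.lean).
-/

noncomputable section

open Matrix Complex
open scoped ComplexOrder Matrix.Norms.L2Operator

namespace Literature.Barriers.HubbardSuperconductivity

open Literature.MathematicalPhysics.QuantumLattice

namespace EpsilonLift

variable {n : Type*} [Fintype n] [DecidableEq n]

/-! ### The block constructors -/

/-- The lift `A ⊕ d`: the matrix `A` with one extra level at (real) energy `d`, block-diagonal on `n ⊕ Unit`.
[folklore] -/
def lift (A : Matrix n n ℂ) (d : ℝ) : Matrix (n ⊕ Unit) (n ⊕ Unit) ℂ :=
  Matrix.fromBlocks A 0 0 ((d : ℂ) • (1 : Matrix Unit Unit ℂ))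

/-- The lifted observable `X ⊕ 0` (the extra level carries no `X`). [folklore] -/
def liftOp (X : Matrix n n ℂ) : Matrix (n ⊕ Unit) (n ⊕ Unit) ℂ :=
  Matrix.fromBlocks X 0 0 0

/-- The `n`-part `wₙ` of a vector `w` on `n ⊕ Unit`. [folklore] -/
def vecN (w : n ⊕ Unit → ℂ) : n → ℂ := fun j => w (Sum.inl j)

omit [Fintype n] [DecidableEq n] in
/-- Components of the `n`-part. [folklore] -/
@[simp] private theorem vecN_apply (w : n ⊕ Unit → ℂ) (j : n) : vecN w j = w (Sum.inl j) := rfl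

/-- `d·1` on the one-point index type is Hermitian for real `d`. [folklore] -/
private theorem isHermitian_smul_one_unit (d : ℝ) : ((d : ℂ) • (1 : Matrix Unit Unit ℂ)).IsHermitian := by
  unfold Matrix.IsHermitian
  rw [conjTranspose_smul, conjTranspose_one, Complex.star_def, Complex.conj_ofReal]

omit [Fintype n] [DecidableEq n] in
/-- The lift of a Hermitian matrix is Hermitian. [cite: Tasaki2020, App. A.2] -/
theorem isHermitian_lift {A : Matrix n n ℂ} (hA : A.IsHermitian) (d : ℝ) : (lift A d).IsHermitian :=
  Matrix.IsHermitian.fromBlocks hA (by simp) (isHermitian_smul_one_unit d)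

omit [Fintype n] [DecidableEq n] in
/-- The lifted observable of a Hermitian matrix is Hermitian. [cite: Tasaki2020, App. A.2] -/
theorem isHermitian_liftOp {X : Matrix n n ℂ} (hX : X.IsHermitian) : (liftOp X).IsHermitian :=
  Matrix.IsHermitian.fromBlocks hX (by simp) (by simp)

omit [Fintype n] [DecidableEq n] in
/-- Sourcing commutes with lifting: `(A ⊕ d) − h (O ⊕ 0) = (A − hO) ⊕ d`. [cite: Tasaki2020, App. A.2] -/
theorem lift_sub_smul_liftOp (A O : Matrix n n ℂ) (d : ℝ) (h : ℂ) :
    lift A d - h • liftOp O = lift (A - h • O) d := by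
  ext (i | i) (j | j) <;> simp [lift, liftOp]

omit [DecidableEq n] in
/-- Products of lifted observables: `(X ⊕ 0)(Y ⊕ 0) = XY ⊕ 0`. [cite: Tasaki2020, App. A.2] -/
theorem liftOp_mul (X Y : Matrix n n ℂ) : liftOp X * liftOp Y = liftOp (X * Y) := by
  simp [liftOp, Matrix.fromBlocks_multiply]

omit [Fintype n] [DecidableEq n] in
/-- Adjoint of a lifted observable: `(X ⊕ 0)ᴴ = Xᴴ ⊕ 0`. [cite: Tasaki2020, App. A.2] -/
theorem liftOp_conjTranspose (X : Matrix n n ℂ) : (liftOp X)ᴴ = liftOp Xᴴ := by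
  simp [liftOp, Matrix.fromBlocks_conjTranspose]

omit [DecidableEq n] in
/-- **Symmetries transport:** if `C` commutes with `A` then `C ⊕ 0` commutes with `A ⊕ d`. [cite: Tasaki2020, App. A.2] -/
theorem liftOp_mul_lift_comm {A C : Matrix n n ℂ} (hC : C * A = A * C) (d : ℝ) :
    liftOp C * lift A d = lift A d * liftOp C := by
  simp [lift, liftOp, Matrix.fromBlocks_multiply, hC]

omit [DecidableEq n] in
/-- Commutators lift: `(X ⊕ 0)(C ⊕ 0) − (C ⊕ 0)(X ⊕ 0) = (XC − CX) ⊕ 0` (so e.g. Koma–Tasaki's `[O, C] = ∓iO'`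
relations hold for the lifted operators). [cite: Tasaki2020, App. A.2] -/
theorem liftOp_comm (X C : Matrix n n ℂ) :
    liftOp X * liftOp C - liftOp C * liftOp X = liftOp (X * C - C * X) := by
  rw [liftOp_mul, liftOp_mul]
  ext (i | i) (j | j) <;> simp [liftOp]

/-! ### Action on vectors and Rayleigh quotients -/

omit [DecidableEq n] in
/-- The `n`-components of `(A ⊕ d) w`. [folklore] -/
private theorem lift_mulVec_inl (A : Matrix n n ℂ) (d : ℝ) (w : n ⊕ Unit → ℂ) (i : n) :
    (lift A d *ᵥ w) (Sum.inl i) = (A *ᵥ vecN w) i := by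
  simp [lift, mulVec, dotProduct, Fintype.sum_sum_type, vecN]

omit [DecidableEq n] in
/-- The extra component of `(A ⊕ d) w`. [folklore] -/
private theorem lift_mulVec_inr (A : Matrix n n ℂ) (d : ℝ) (w : n ⊕ Unit → ℂ) (u : Unit) :
    (lift A d *ᵥ w) (Sum.inr u) = (d : ℂ) * w (Sum.inr ()) := by
  simp [lift, mulVec, dotProduct, Fintype.sum_sum_type]

omit [DecidableEq n] in
/-- The `n`-components of `(X ⊕ 0) w`. [folklore] -/
private theorem liftOp_mulVec_inl (X : Matrix n n ℂ) (w : n ⊕ Unit → ℂ) (i : n) :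
    (liftOp X *ᵥ w) (Sum.inl i) = (X *ᵥ vecN w) i := by
  simp [liftOp, mulVec, dotProduct, Fintype.sum_sum_type, vecN]

omit [DecidableEq n] in
/-- The extra component of `(X ⊕ 0) w` vanishes. [folklore] -/
private theorem liftOp_mulVec_inr (X : Matrix n n ℂ) (w : n ⊕ Unit → ℂ) (u : Unit) :
    (liftOp X *ᵥ w) (Sum.inr u) = 0 := by
  simp [liftOp, mulVec, dotProduct, Fintype.sum_sum_type]

omit [DecidableEq n] in
/-- Squared norm of a vector on `n ⊕ Unit`: `⟨w, w⟩ = ⟨wₙ, wₙ⟩ + |w₁|²`. [folklore] -/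
private theorem star_dotProduct_self_sum (w : n ⊕ Unit → ℂ) :
    star w ⬝ᵥ w = star (vecN w) ⬝ᵥ vecN w + (starRingEnd ℂ) (w (Sum.inr ())) * w (Sum.inr ()) := by
  simp [dotProduct, Fintype.sum_sum_type, vecN]

omit [DecidableEq n] in
/-- Rayleigh numerator of the lift: `⟨w, (A ⊕ d) w⟩ = ⟨wₙ, A wₙ⟩ + d |w₁|²`. [folklore] -/
private theorem star_dotProduct_lift_mulVec (A : Matrix n n ℂ) (d : ℝ) (w : n ⊕ Unit → ℂ) :
    star w ⬝ᵥ (lift A d *ᵥ w) =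
      star (vecN w) ⬝ᵥ (A *ᵥ vecN w) + (d : ℂ) * ((starRingEnd ℂ) (w (Sum.inr ())) * w (Sum.inr ())) := by
  rw [dotProduct, Fintype.sum_sum_type]
  simp only [Pi.star_apply, lift_mulVec_inl, lift_mulVec_inr, Fintype.univ_ofSubsingleton,
    Finset.sum_singleton, Complex.star_def]
  rw [dotProduct]
  simp only [Pi.star_apply, vecN, Complex.star_def]
  ring

omit [DecidableEq n] in
/-- Rayleigh numerator of a lifted observable: `⟨w, (X ⊕ 0) w⟩ = ⟨wₙ, X wₙ⟩`. [cite: Tasaki2020, App. A.2] -/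
theorem star_dotProduct_liftOp_mulVec (X : Matrix n n ℂ) (w : n ⊕ Unit → ℂ) :
    star w ⬝ᵥ (liftOp X *ᵥ w) = star (vecN w) ⬝ᵥ (X *ᵥ vecN w) := by
  rw [dotProduct, Fintype.sum_sum_type]
  simp only [Pi.star_apply, liftOp_mulVec_inl, liftOp_mulVec_inr, mul_zero, Finset.sum_const_zero, add_zero]
  rfl

/-- `|z|²` as `conj z · z` is the real number `‖z‖²`. [folklore] -/
private theorem conj_mul_self_eq (z : ℂ) : (starRingEnd ℂ) z * z = ((‖z‖ ^ 2 : ℝ) : ℂ) := by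
  rw [← Complex.normSq_eq_conj_mul_self, Complex.normSq_eq_norm_sq]

omit [DecidableEq n] in
/-- `⟨v, v⟩` is the real number `Re⟨v, v⟩ ≥ 0`. [folklore] -/
private theorem star_dotProduct_self_eq_re (v : n → ℂ) :
    star v ⬝ᵥ v = (((star v ⬝ᵥ v).re : ℝ) : ℂ) ∧ 0 ≤ (star v ⬝ᵥ v).re := by
  have h0 : (0 : ℂ) ≤ star v ⬝ᵥ v := dotProduct_star_self_nonneg v
  obtain ⟨hre, him⟩ := Complex.nonneg_iff.mp h0
  exact ⟨Complex.ext (by simp) (by simp [← him]), by simpa using hre⟩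

/-- Un-normalised variational principle: `E₀(A)·⟨x, x⟩ ≤ Re⟨x, A x⟩` (restates the Summits-side
`Summit.HubbardSuperconductivity.HubbardSuperconductivity.Theorems.CwSecondOrder.groundEnergy_mul_re_le`, which a
Literature file cannot import). [cite: Tasaki2020, §2.1 (2.1.6)] -/
private theorem groundEnergy_mul_le_rayleigh {A : Matrix n n ℂ} (hA : A.IsHermitian) (x : n → ℂ) :
    A.groundEnergy * (star x ⬝ᵥ x).re ≤ (star x ⬝ᵥ (A *ᵥ x)).re := by
  have h := (posSemidef_sub_groundEnergy hA).dotProduct_mulVec_nonneg x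
  rw [sub_mulVec, dotProduct_sub, Algebra.algebraMap_eq_smul_one, smul_mulVec, one_mulVec,
    dotProduct_smul] at h
  obtain ⟨hre, -⟩ := Complex.nonneg_iff.mp h
  simp only [Complex.sub_re, Complex.real_smul, Complex.re_ofReal_mul] at hre
  linarith

/-- A Hermitian matrix on a nonempty index type has a NORMALISED ground-state vector. [cite: Tasaki2020, §2.1] -/
theorem exists_unit_mem_groundSpace {A : Matrix n n ℂ} (hA : A.IsHermitian) [Nonempty n] :
    ∃ ψ : n → ℂ, ψ ∈ A.groundSpace ∧ star ψ ⬝ᵥ ψ = 1 := by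
  -- adapted from the `hne` step of `Matrix.minEnergyOn_top_holds` (FinDimSpectrumProofs)
  obtain ⟨v, hv, hv0⟩ := (Submodule.ne_bot_iff _).1 (groundSpace_ne_bot_holds hA)
  obtain ⟨hvre, hvnn⟩ := star_dotProduct_self_eq_re v
  have hpos : 0 < (star v ⬝ᵥ v).re := by
    rcases eq_or_lt_of_le hvnn with h | h
    · exfalso
      have : star v ⬝ᵥ v = 0 := by rw [hvre, ← h]; simp
      exact hv0 ((dotProduct_star_self_eq_zero).1 this)
    · exact h
  set r : ℝ := Real.sqrt (star v ⬝ᵥ v).re with hr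
  have hr0 : 0 < r := Real.sqrt_pos.2 hpos
  refine ⟨((r : ℂ))⁻¹ • v, A.groundSpace.smul_mem _ hv, ?_⟩
  rw [star_smul, smul_dotProduct, dotProduct_smul, hvre, smul_eq_mul, smul_eq_mul, Complex.star_def,
    map_inv₀, Complex.conj_ofReal]
  have hsq : (star v ⬝ᵥ v).re = r * r := by
    rw [hr, Real.mul_self_sqrt hvnn]
  rw [hsq]
  have hr0' : (r : ℂ) ≠ 0 := by exact_mod_cast hr0.ne'
  push_cast
  field_simp

/-! ### Ground energy of the lift -/

variable [Nonempty n]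

/-- **Ground energy of a block-diagonal matrix:** `E₀(A ⊕ d) = min(E₀(A), d)`. [cite: Tasaki2020, §2.1 and App. A.2] -/
theorem groundEnergy_lift {A : Matrix n n ℂ} (hA : A.IsHermitian) (d : ℝ) :
    (lift A d).groundEnergy = min A.groundEnergy d := by
  have hL := isHermitian_lift hA d
  apply le_antisymm
  · -- two trial vectors: a ground vector of `A`, and the extra level
    apply le_min
    · obtain ⟨ψ, hψ, hψ1⟩ := exists_unit_mem_groundSpace hA
      set w : n ⊕ Unit → ℂ := Sum.elim ψ 0 with hw
      have hwN : vecN w = ψ := by funext j; simp [vecN, hw]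
      have hw1 : star w ⬝ᵥ w = 1 := by
        rw [star_dotProduct_self_sum, hwN, hψ1]; simp [hw]
      have h1 := groundEnergy_le_rayleigh_holds hL w hw1
      have hw0 : w (Sum.inr ()) = 0 := by simp [hw]
      rw [star_dotProduct_lift_mulVec, hwN, hw0, map_zero, mul_zero, mul_zero, add_zero,
        (rayleigh_eq_groundEnergy_iff_holds hA ψ hψ1).2 hψ] at h1
      exact h1
    · set w : n ⊕ Unit → ℂ := Sum.elim 0 (fun _ => 1) with hw
      have hwN : vecN w = 0 := by funext j; simp [vecN, hw]
      have hw1 : star w ⬝ᵥ w = 1 := by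
        rw [star_dotProduct_self_sum, hwN]; simp [hw]
      have h1 := groundEnergy_le_rayleigh_holds hL w hw1
      rw [star_dotProduct_lift_mulVec, hwN] at h1
      simpa [hw] using h1
  · -- a normalised ground vector of the lift has Rayleigh quotient `≥ min`
    obtain ⟨w, hw, hw1⟩ := exists_unit_mem_groundSpace hL
    have hE : (star w ⬝ᵥ (lift A d *ᵥ w)).re = (lift A d).groundEnergy :=
      (rayleigh_eq_groundEnergy_iff_holds hL w hw1).2 hw
    rw [← hE, star_dotProduct_lift_mulVec, Complex.add_re, conj_mul_self_eq, ← Complex.ofReal_mul,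
      Complex.ofReal_re]
    obtain ⟨hNre, hNnn⟩ := star_dotProduct_self_eq_re (vecN w)
    have hsum : (star (vecN w) ⬝ᵥ vecN w).re + ‖w (Sum.inr ())‖ ^ 2 = 1 := by
      have := congrArg Complex.re hw1
      rw [star_dotProduct_self_sum, conj_mul_self_eq, Complex.add_re, Complex.ofReal_re, Complex.one_re] at this
      exact this
    have h1 := groundEnergy_mul_le_rayleigh hA (vecN w)
    have h2 : min A.groundEnergy d * (star (vecN w) ⬝ᵥ vecN w).re ≤
        A.groundEnergy * (star (vecN w) ⬝ᵥ vecN w).re :=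
      mul_le_mul_of_nonneg_right (min_le_left _ _) hNnn
    have h3 : min A.groundEnergy d * ‖w (Sum.inr ())‖ ^ 2 ≤ d * ‖w (Sum.inr ())‖ ^ 2 :=
      mul_le_mul_of_nonneg_right (min_le_right _ _) (by positivity)
    calc min A.groundEnergy d
        = min A.groundEnergy d * ((star (vecN w) ⬝ᵥ vecN w).re + ‖w (Sum.inr ())‖ ^ 2) := by rw [hsum, mul_one]
      _ ≤ _ := by rw [mul_add]; linarith

/-! ### The ground space of the lift when one block wins strictly -/

/-- **The extra level wins (`d < E₀(A)`):** every ground vector of `A ⊕ d` has vanishing `n`-part. [cite: Tasaki2020, §2.1 and App. A.2] -/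
theorem inl_eq_zero_of_mem_groundSpace_lift {A : Matrix n n ℂ} (hA : A.IsHermitian) {d : ℝ}
    (hd : d < A.groundEnergy) {w : n ⊕ Unit → ℂ} (hw : w ∈ (lift A d).groundSpace) (i : n) :
    w (Sum.inl i) = 0 := by
  have hE : (lift A d).groundEnergy = d := by rw [groundEnergy_lift hA, min_eq_right hd.le]
  have hev := (mem_groundSpace_iff _ _).1 hw
  rw [hE] at hev
  -- `A wₙ = d wₙ`
  have hAn : A *ᵥ vecN w = (d : ℂ) • vecN w := by
    funext j
    have := congrFun hev (Sum.inl j)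
    rw [lift_mulVec_inl] at this
    simpa [vecN] using this
  -- Rayleigh: `E₀(A)⟨wₙ,wₙ⟩ ≤ Re⟨wₙ, A wₙ⟩ = d ⟨wₙ,wₙ⟩`
  have h1 := groundEnergy_mul_le_rayleigh hA (vecN w)
  rw [hAn, dotProduct_smul, smul_eq_mul, Complex.re_ofReal_mul] at h1
  obtain ⟨hNre, hNnn⟩ := star_dotProduct_self_eq_re (vecN w)
  have hzero : (star (vecN w) ⬝ᵥ vecN w).re = 0 := by nlinarith
  have hN0 : vecN w = 0 := by
    apply (dotProduct_star_self_eq_zero).1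
    rw [hNre, hzero]; simp
  exact congrFun hN0 i

/-- When the extra level wins, the ground projection of the lift annihilates the `n`-rows:
`P₀ (inl i) j = 0`. [folklore] -/
private theorem groundProj_lift_inl_eq_zero {A : Matrix n n ℂ} (hA : A.IsHermitian) {d : ℝ}
    (hd : d < A.groundEnergy) (i : n) (j : n ⊕ Unit) : (lift A d).groundProj (Sum.inl i) j = 0 := by
  have hmem := groundProj_mulVec_mem (lift A d) (Pi.single j 1)
  have h := inl_eq_zero_of_mem_groundSpace_lift hA hd hmem i
  simp only [Matrix.mulVec_single, MulOpposite.op_one, one_smul] at h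
  exact h

/-- **No order in the inert ground state:** for `d < E₀(A)` the tracial ground state of `A ⊕ d` gives `0` to
every lifted observable `X ⊕ 0`. [cite: Tasaki2020, §2.1 and App. A.2] -/
theorem groundStateFunctional_lift_liftOp_of_lt {A : Matrix n n ℂ} (hA : A.IsHermitian) {d : ℝ}
    (hd : d < A.groundEnergy) (X : Matrix n n ℂ) :
    (lift A d).groundStateFunctional (liftOp X) = 0 := by
  rw [groundStateFunctional_apply]
  have htr : ((lift A d).groundProj * liftOp X).trace = 0 := by
    rw [Matrix.trace]
    refine Finset.sum_eq_zero fun i _ => ?_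
    rw [Matrix.diag, Matrix.mul_apply]
    refine Finset.sum_eq_zero fun j _ => ?_
    rcases i with i | u
    · rw [groundProj_lift_inl_eq_zero hA hd i j, zero_mul]
    · rcases j with j | v <;> simp [liftOp]
  rw [htr, mul_zero]

/-- For `d < E₀(A)`, every ground VECTOR of the lift has vanishing expectation of every lifted observable
(one-point AND two-point: no response, no long-range order). [cite: Tasaki2020, §2.1 and App. A.2] -/
theorem rayleigh_liftOp_eq_zero_of_lt {A : Matrix n n ℂ} (hA : A.IsHermitian) {d : ℝ}
    (hd : d < A.groundEnergy) {w : n ⊕ Unit → ℂ} (hw : w ∈ (lift A d).groundSpace) (X : Matrix n n ℂ) :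
    star w ⬝ᵥ (liftOp X *ᵥ w) = 0 := by
  rw [star_dotProduct_liftOp_mulVec]
  have h0 : vecN w = 0 := funext fun j => inl_eq_zero_of_mem_groundSpace_lift hA hd hw j
  rw [h0]; simp

/-- **The physical block wins (`E₀(A) < d`):** the ground space of `A ⊕ d` is `groundSpace A ⊕ 0`. [cite: Tasaki2020, §2.1 and App. A.2] -/
theorem mem_groundSpace_lift_iff {A : Matrix n n ℂ} (hA : A.IsHermitian) {d : ℝ} (hd : A.groundEnergy < d)
    (w : n ⊕ Unit → ℂ) :
    w ∈ (lift A d).groundSpace ↔ vecN w ∈ A.groundSpace ∧ w (Sum.inr ()) = 0 := by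
  have hE : (lift A d).groundEnergy = A.groundEnergy := by rw [groundEnergy_lift hA, min_eq_left hd.le]
  rw [mem_groundSpace_iff, mem_groundSpace_iff, hE]
  constructor
  · intro hev
    refine ⟨?_, ?_⟩
    · funext j
      have := congrFun hev (Sum.inl j)
      rw [lift_mulVec_inl] at this
      rw [this]
      rfl
    · have := congrFun hev (Sum.inr ())
      rw [lift_mulVec_inr] at this
      simp only [Pi.smul_apply, smul_eq_mul] at this
      have hne : ((d : ℂ)) - (A.groundEnergy : ℂ) ≠ 0 := by
        rw [← Complex.ofReal_sub, Ne, Complex.ofReal_eq_zero]; exact (sub_pos.2 hd).ne'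
      have h2 : (((d : ℂ)) - (A.groundEnergy : ℂ)) * w (Sum.inr ()) = 0 := by rw [sub_mul, this, sub_self]
      exact (mul_eq_zero.1 h2).resolve_left hne
  · rintro ⟨hN, h1⟩
    funext i
    rcases i with i | u
    · rw [lift_mulVec_inl, congrFun hN i]
      rfl
    · rw [lift_mulVec_inr, h1]
      simp [h1]

/-- **Uniqueness of orthogonal projections by their range:** two Hermitian matrices that both map every vector
into a set `K` and fix `K` pointwise are equal. [cite: Tasaki2020, §2.1 and App. A.2] -/
theorem proj_unique {m : Type*} [Fintype m] [DecidableEq m] {P P' : Matrix m m ℂ} {K : Set (m → ℂ)}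
    (hP : P.IsHermitian) (hP' : P'.IsHermitian)
    (hPK : ∀ u, P *ᵥ u ∈ K) (hPfix : ∀ v ∈ K, P *ᵥ v = v)
    (hP'K : ∀ u, P' *ᵥ u ∈ K) (hP'fix : ∀ v ∈ K, P' *ᵥ v = v) : P = P' := by
  have h1 : P' * P = P := by
    apply Matrix.ext_of_mulVec_single  -- columns
    intro j
    rw [← mulVec_mulVec, hP'fix _ (hPK _)]
  have h2 : P * P' = P' := by
    apply Matrix.ext_of_mulVec_single
    intro j
    rw [← mulVec_mulVec, hPfix _ (hP'K _)]
  -- `P = (P'P)ᴴ = P P' = P'`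
  calc P = Pᴴ := hP.symm
    _ = (P' * P)ᴴ := by rw [h1]
    _ = Pᴴ * P'ᴴ := conjTranspose_mul _ _
    _ = P * P' := by rw [hP, hP']
    _ = P' := h2

/-- For `E₀(A) < d` the ground projection of `A ⊕ d` is `P₀(A) ⊕ 0`. [cite: Tasaki2020, §2.1 and App. A.2] -/
theorem groundProj_lift_eq {A : Matrix n n ℂ} (hA : A.IsHermitian) {d : ℝ} (hd : A.groundEnergy < d) :
    (lift A d).groundProj = liftOp A.groundProj := by
  refine proj_unique (K := ((lift A d).groundSpace : Set (n ⊕ Unit → ℂ))) (groundProj_isHermitian _)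
    (isHermitian_liftOp (groundProj_isHermitian A)) (fun u => groundProj_mulVec_mem _ u)
    (fun v hv => groundProj_mulVec_of_mem _ hv) (fun u => ?_) (fun v hv => ?_)
  · -- `(P₀(A) ⊕ 0) u = (P₀(A) uₙ, 0)` lies in `groundSpace A ⊕ 0`
    show liftOp A.groundProj *ᵥ u ∈ (lift A d).groundSpace
    rw [mem_groundSpace_lift_iff hA hd]
    refine ⟨?_, liftOp_mulVec_inr _ _ _⟩
    have : vecN (liftOp A.groundProj *ᵥ u) = A.groundProj *ᵥ vecN u := by
      funext j; rw [vecN_apply, liftOp_mulVec_inl]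
    rw [this]
    exact groundProj_mulVec_mem A _
  · -- it fixes `groundSpace A ⊕ 0`
    have hv' := (mem_groundSpace_lift_iff hA hd v).1 hv
    funext i
    rcases i with i | u
    · rw [liftOp_mulVec_inl]
      exact congrFun (groundProj_mulVec_of_mem A hv'.1) i
    · rw [liftOp_mulVec_inr, hv'.2]

/-- **The physical block wins:** for `E₀(A) < d` the tracial ground state of `A ⊕ d` agrees with that of `A` on
every lifted observable. [cite: Tasaki2020, §2.1 and App. A.2] -/
theorem groundStateFunctional_lift_liftOp_of_gt {A : Matrix n n ℂ} (hA : A.IsHermitian) {d : ℝ}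
    (hd : A.groundEnergy < d) (X : Matrix n n ℂ) :
    (lift A d).groundStateFunctional (liftOp X) = A.groundStateFunctional X := by
  rw [groundStateFunctional_apply, groundStateFunctional_apply, groundProj_lift_eq hA hd, liftOp_mul]
  simp [liftOp, Matrix.trace, Fintype.sum_sum_type]

/-! ### The ε-lift of a sourced family -/

/-- **Energies of the ε-lift.** For Hermitian `H`, `O` with `Re ω_H(O) = 0`, every `ε` and every field `h`:
`E₀((H ⊕ (E₀(H) − ε)) − h(O ⊕ 0)) = min(E₀(H − hO), E₀(H) − ε)`, and this lies in `[E₀(H − hO) − ε, E₀(H − hO)]`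
when `ε ≥ 0`. [cite: KomaTasaki1994, §1] -/
theorem groundEnergy_epsLift {H O : Matrix n n ℂ} (hH : H.IsHermitian) (hO : O.IsHermitian)
    (h0 : (H.groundStateFunctional O).re = 0) {ε : ℝ} (hε : 0 ≤ ε) (h : ℝ) :
    (lift H (H.groundEnergy - ε) - (h : ℂ) • liftOp O).groundEnergy =
        min (H - (h : ℂ) • O).groundEnergy (H.groundEnergy - ε) ∧
      (H - (h : ℂ) • O).groundEnergy - ε ≤ (lift H (H.groundEnergy - ε) - (h : ℂ) • liftOp O).groundEnergy ∧
      (lift H (H.groundEnergy - ε) - (h : ℂ) • liftOp O).groundEnergy ≤ (H - (h : ℂ) • O).groundEnergy := by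
  have hAh := isHermitian_sub_real_smul hH hO h
  have hmin : (lift H (H.groundEnergy - ε) - (h : ℂ) • liftOp O).groundEnergy =
      min (H - (h : ℂ) • O).groundEnergy (H.groundEnergy - ε) := by
    rw [lift_sub_smul_liftOp, groundEnergy_lift hAh]
  have hle := groundEnergy_source_le_of_re_eq_zero hH hO h0 h
  refine ⟨hmin, ?_, ?_⟩
  · rw [hmin]
    exact le_min (by linarith) (by linarith)
  · rw [hmin]; exact min_le_left _ _

/-- **Identical sourced states where the gain exceeds ε:** if `E₀(H) − E₀(H − hO) > ε` then the tracial ground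
state of the lifted sourced Hamiltonian agrees with the physical one on every lifted observable. [cite: KomaTasaki1994, §1] -/
theorem groundStateFunctional_epsLift_of_gain_gt {H O : Matrix n n ℂ} (hH : H.IsHermitian) (hO : O.IsHermitian)
    {ε : ℝ} (h : ℝ) (hgain : ε < H.groundEnergy - (H - (h : ℂ) • O).groundEnergy) (X : Matrix n n ℂ) :
    (lift H (H.groundEnergy - ε) - (h : ℂ) • liftOp O).groundStateFunctional (liftOp X) =
      (H - (h : ℂ) • O).groundStateFunctional X := by
  rw [lift_sub_smul_liftOp]
  exact groundStateFunctional_lift_liftOp_of_gt (isHermitian_sub_real_smul hH hO h) (by linarith) X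

/-- **No order where the gain is below ε:** if `E₀(H) − E₀(H − hO) < ε` then the tracial ground state of the
lifted sourced Hamiltonian is the inert level and gives `0` to every lifted observable. [cite: KomaTasaki1994, §1] -/
theorem groundStateFunctional_epsLift_of_gain_lt {H O : Matrix n n ℂ} (hH : H.IsHermitian) (hO : O.IsHermitian)
    {ε : ℝ} (h : ℝ) (hgain : H.groundEnergy - (H - (h : ℂ) • O).groundEnergy < ε) (X : Matrix n n ℂ) :
    (lift H (H.groundEnergy - ε) - (h : ℂ) • liftOp O).groundStateFunctional (liftOp X) = 0 := by
  rw [lift_sub_smul_liftOp]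
  exact groundStateFunctional_lift_liftOp_of_lt (isHermitian_sub_real_smul hH hO h) (by linarith) X

/-- **The gain is small at small field:** `E₀(H) − E₀(H − hO) ≤ |h|·‖O‖` (Hellmann–Feynman chord and
`|Re ω(O)| ≤ ‖O‖`). [cite: KomaTasaki1994, §1] -/
theorem gain_le_abs_mul_norm {H O : Matrix n n ℂ} (hH : H.IsHermitian) (hO : O.IsHermitian) (h : ℝ) :
    H.groundEnergy - (H - (h : ℂ) • O).groundEnergy ≤ |h| * ‖O‖ := by
  have h1 := sub_groundEnergy_le_sub_mul_re_groundStateFunctional hH hO h 0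
  simp only [Complex.ofReal_zero, zero_smul, sub_zero] at h1
  have h2 := abs_re_groundStateFunctional_le_norm (A := H - (h : ℂ) • O) (isHermitian_sub_real_smul hH hO h) O
  calc H.groundEnergy - (H - (h : ℂ) • O).groundEnergy
      ≤ h * ((H - (h : ℂ) • O).groundStateFunctional O).re := by linarith
    _ ≤ |h * ((H - (h : ℂ) • O).groundStateFunctional O).re| := le_abs_self _
    _ = |h| * |((H - (h : ℂ) • O).groundStateFunctional O).re| := abs_mul _ _
    _ ≤ |h| * ‖O‖ := mul_le_mul_of_nonneg_left h2 (abs_nonneg _)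

/-- **The ε-lift profile** (everything in one statement).  For Hermitian `H`, `O` on a nonempty finite index
type with `Re ω_H(O) = 0` and `ε > 0`, with `H̃ = H ⊕ (E₀(H) − ε)`, `Õ = O ⊕ 0`:
(o) `H̃`, `Õ` Hermitian; symmetries `C` of `H` lift to symmetries `C ⊕ 0` of `H̃` with lifted commutators;
(i) for every `h`: `E₀(H̃ − hÕ) = min(E₀(H − hO), E₀(H) − ε) ∈ [E₀(H − hO) − ε, E₀(H − hO)]`;
(ii) gain `> ε` ⇒ `ω̃_h(X ⊕ 0) = ω_h(X)` for all `X`;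
(iii) gain `< ε` ⇒ `ω̃_h(X ⊕ 0) = 0` for all `X`, in particular for all `|h| < ε/‖O‖` (and at `h = 0`: no LRO, `ω̃_0(ÕᴴÕ) = 0`).
[cite: KomaTasaki1994, §1 and §2.5] -/
theorem sourcedResponseEpsilonLift_profile {H O : Matrix n n ℂ} (hH : H.IsHermitian) (hO : O.IsHermitian)
    (h0 : (H.groundStateFunctional O).re = 0) {ε : ℝ} (hε : 0 < ε) :
    (lift H (H.groundEnergy - ε)).IsHermitian ∧ (liftOp O).IsHermitian ∧
    (∀ C : Matrix n n ℂ, C * H = H * C → liftOp C * lift H (H.groundEnergy - ε) = lift H (H.groundEnergy - ε) * liftOp C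
      ∧ liftOp O * liftOp C - liftOp C * liftOp O = liftOp (O * C - C * O)) ∧
    (∀ h : ℝ, (lift H (H.groundEnergy - ε) - (h : ℂ) • liftOp O).groundEnergy =
        min (H - (h : ℂ) • O).groundEnergy (H.groundEnergy - ε) ∧
      (H - (h : ℂ) • O).groundEnergy - ε ≤ (lift H (H.groundEnergy - ε) - (h : ℂ) • liftOp O).groundEnergy ∧
      (lift H (H.groundEnergy - ε) - (h : ℂ) • liftOp O).groundEnergy ≤ (H - (h : ℂ) • O).groundEnergy) ∧
    (∀ h : ℝ, ε < H.groundEnergy - (H - (h : ℂ) • O).groundEnergy → ∀ X : Matrix n n ℂ,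
      (lift H (H.groundEnergy - ε) - (h : ℂ) • liftOp O).groundStateFunctional (liftOp X) =
        (H - (h : ℂ) • O).groundStateFunctional X) ∧
    (∀ h : ℝ, H.groundEnergy - (H - (h : ℂ) • O).groundEnergy < ε → ∀ X : Matrix n n ℂ,
      (lift H (H.groundEnergy - ε) - (h : ℂ) • liftOp O).groundStateFunctional (liftOp X) = 0) ∧
    (∀ h : ℝ, |h| * ‖O‖ < ε → ∀ X : Matrix n n ℂ,
      (lift H (H.groundEnergy - ε) - (h : ℂ) • liftOp O).groundStateFunctional (liftOp X) = 0) ∧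
    (lift H (H.groundEnergy - ε)).groundStateFunctional (liftOp (Oᴴ * O)) = 0 := by
  refine ⟨isHermitian_lift hH _, isHermitian_liftOp hO, fun C hC => ⟨liftOp_mul_lift_comm hC _, liftOp_comm O C⟩,
    fun h => groundEnergy_epsLift hH hO h0 hε.le h,
    fun h hg X => groundStateFunctional_epsLift_of_gain_gt hH hO h hg X,
    fun h hg X => groundStateFunctional_epsLift_of_gain_lt hH hO h hg X,
    fun h hsmall X => groundStateFunctional_epsLift_of_gain_lt hH hO h
      ((gain_le_abs_mul_norm hH hO h).trans_lt hsmall) X, ?_⟩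
  have := groundStateFunctional_epsLift_of_gain_lt hH hO (ε := ε) 0 (by simp; exact hε) (Oᴴ * O)
  simpa using this

end EpsilonLift

open EpsilonLift

/-- **BARRIER `SourcedResponseEpsilonLift` (finite-precision sourced data never floor the order).**  For every
finite-dimensional Hermitian `H` and `O` (nonempty index type) with `Re ω_H(O) = 0` and every precision `ε > 0`
there are Hermitian `H̃`, `Õ` on a larger finite index type and a `*`-compatible embedding `X ↦ X̃` of observables
(`X̃Ỹ = (XY)~`, `X̃ᴴ = (Xᴴ)~`, `Õ` the image of `O`, symmetries of `H` mapping to symmetries of `H̃` with the same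
commutators against `Õ`) such that for every field `h`:
(i) `E₀(H − hO) − ε ≤ E₀(H̃ − hÕ) ≤ E₀(H − hO)` (all sourced energies reproduced to precision ε);
(ii) if the gain `E₀(H) − E₀(H − hO)` exceeds `ε`: `ω̃_h(X̃) = ω_h(X)` for every `X` (identical sourced ground states
— response, structure factors, everything);
(iii) if the gain is below `ε`, in particular for all `|h| < ε/‖O‖`: `ω̃_h(X̃) = 0` for every `X` — at `h = 0` no
long-range order (`ω̃_0((OᴴO)~) = 0`) and the response vanishes identically near `h = 0` (order parameter `0`).
Consequently any implication "certified sourced data of precision ε (energy windows; rows in sourced ground states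
at fields of gain > ε) ⇒ floor on LRO or on the `h → 0⁺` order parameter" fails at EVERY ε over any class of
systems closed under the lift `H ↦ H ⊕ (E₀(H) − ε)`; what data can constrain is only the small-field gain (a
volume-uniform modulus at `0⁺`) or locality at total-energy resolution ε.  Witness: `EpsilonLift.lift`,
`EpsilonLift.liftOp` on `n ⊕ Unit`.

technique_class: symmetry-breaking-field pinning-field finite-field-response finite-precision-data epsilon-lift quasi-average Koma-Tasaki-converse response-to-LRO-transfer energy-chord inert-level
blocks: "finitely many certified sourced data of precision ε ⇒ FLOOR on ground-state LRO or on the quasi-average" as a transfer principle over classes of `U(1)` systems closed under adjoining an inert charge-neutral level (cell `hubbard-cq` obstruction O2, census (13); LADDER row PC-a).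
because: the ε-lift reproduces all sourced ground energies within ε and all sourced ground states of gain `> ε` exactly while having no order (`SourcedResponseEpsilonLift_holds`); printed theory runs LRO ⇒ response only [cite: KomaTasaki1994, Corollary 2.9 and §2.5] [cite: LiebSeiringerYngvason2007, §3].
evasions_known: certify the small-field gain / a modulus at `0⁺` (floor-type); strict locality below total energy `E₀ + ε` (total-energy resolution); the proved direction and direct LRO proofs [cite: KennedyLiebShastry1988].
scope_caveats: transfer principles, not models; one global inert level (block-diagonal), site-local version not formalised; ties gain `= ε` excluded.
status: established (theorem `SourcedResponseEpsilonLift_holds`).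
[cite: KomaTasaki1994, §1 and §2.5] [cite: LiebSeiringerYngvason2007, §3] -/
def SourcedResponseEpsilonLift : Prop :=
  ∀ (n : Type) [Fintype n] [DecidableEq n] [Nonempty n] (H O : Matrix n n ℂ),
    H.IsHermitian → O.IsHermitian → (H.groundStateFunctional O).re = 0 → ∀ ε : ℝ, 0 < ε →
    ∃ (m : Type) (_ : Fintype m) (_ : DecidableEq m) (_ : Nonempty m) (Ht : Matrix m m ℂ)
      (emb : Matrix n n ℂ → Matrix m m ℂ),
      Ht.IsHermitian ∧ (emb O).IsHermitian ∧
      (∀ X Y, emb X * emb Y = emb (X * Y)) ∧ (∀ X, (emb X)ᴴ = emb Xᴴ) ∧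
      (∀ C, C * H = H * C → emb C * Ht = Ht * emb C) ∧
      (∀ h : ℝ, (H - (h : ℂ) • O).groundEnergy - ε ≤ (Ht - (h : ℂ) • emb O).groundEnergy ∧
        (Ht - (h : ℂ) • emb O).groundEnergy ≤ (H - (h : ℂ) • O).groundEnergy) ∧
      (∀ h : ℝ, ε < H.groundEnergy - (H - (h : ℂ) • O).groundEnergy → ∀ X,
        (Ht - (h : ℂ) • emb O).groundStateFunctional (emb X) = (H - (h : ℂ) • O).groundStateFunctional X) ∧
      (∀ h : ℝ, H.groundEnergy - (H - (h : ℂ) • O).groundEnergy < ε → ∀ X,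
        (Ht - (h : ℂ) • emb O).groundStateFunctional (emb X) = 0) ∧
      (∀ h : ℝ, |h| * ‖O‖ < ε → ∀ X, (Ht - (h : ℂ) • emb O).groundStateFunctional (emb X) = 0) ∧
      Ht.groundStateFunctional (emb (Oᴴ * O)) = 0

/-- **`SourcedResponseEpsilonLift` holds** — witnessed by `m = n ⊕ Unit`, `Ht = lift H (E₀(H) − ε)`, `emb = liftOp`
(`sourcedResponseEpsilonLift_profile`). [cite: KomaTasaki1994, §1 and §2.5] -/
theorem SourcedResponseEpsilonLift_holds : SourcedResponseEpsilonLift := by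
  intro n _ _ _ H O hH hO h0 ε hε
  obtain ⟨hHt, hOt, hsym, hE, hgt, hlt, hsmall, hlro⟩ := sourcedResponseEpsilonLift_profile hH hO h0 hε
  refine ⟨n ⊕ Unit, inferInstance, inferInstance, inferInstance, lift H (H.groundEnergy - ε), liftOp, hHt, hOt,
    liftOp_mul, liftOp_conjTranspose, fun C hC => (hsym C hC).1, fun h => ⟨(hE h).2.1, (hE h).2.2⟩,
    hgt, hlt, hsmall, hlro⟩

end Literature.Barriers.HubbardSuperconductivity
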